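import Summits.BirchSwinnertonDyer.BirchSwinnertonDyer.Theorems.CyclotomicUntwistFormalEndomorphismFrobenius
import Literature.NumberTheory.EllipticCurves.FormalGroupMultiplicationUniversalProofs
import Literature.NumberTheory.GaloisRepresentations.LubinTate
import HarnessLib

/-!
# Route `CyclotomicUntwist`: endomorphisms of the formal group of a Weierstrass curve, I — the group law
# APPLIED to series (associativity, commutativity, zero, inverse, interchange), linear coefficients, and the
# closure of `End(F)` under `⊕`, `i`, `[n]`, composition (every commutative ring)

Cell `pub/bsd-wall` (D-0145 line `route-BirchSwinnertonDyer-CyclotomicUntwist` rev 9), prover seat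
`bsd-line-cycu-p2` (gen 7), sub-package «W3-core» of the registered stub S2k `stub_KATZ_rankLeTwo_supersingular`
of the lines of record `Lines/dfrob_wan.lean` (K1 = stmt-BirchSwinnertonDyer-21580) / `Lines/dfrob_kato.lean`
(K2 = 21581), elementary Katz-rank route of memo `Cruxes/PSRankOneLowerHalfAtThree/KATZ-FROBENIUS-MOD-VARPI-v2.md`
§2 (iv) («`End_{𝔽_p⟦X⟧}(F̄) = ℤ_p[π]`»). THEOREMS ONLY (no definition, no named fact, no `sorry`); helper
`--supports` 21580; BSD is not proved by this file and no crux or stub is.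

This first file is pure formal-group algebra over an ARBITRARY commutative ring `R`, for the chord–tangent
law `F = W.formalGroupLaw` of any Weierstrass curve `W/R` (tree: the universal axioms
`formalGroupLaw_assoc'/comm'/subst_X_zero'/subst_X_formalNeg'` of `FormalGroupLawAxiomsUniversalProofs`,
`formalMul_add'/formalMul_succ''` of `FormalGroupMultiplicationUniversalProofs`). An "endomorphism" is a
series `h`, `h(0) = 0`, with `h(F(X₀,X₁)) = F(h(X₀), h(X₁))`, written out as in
`CyclotomicUntwistFormalEndomorphismFrobenius` (cycu-p3 g8) — no definition is introduced.

* §1 the law APPLIED to series `u, v, w` without constant term (any number of variables):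
  `subst_subst_pair` / `subst_pair_subst` (substitution passes inside `F(u,v)`), `subst_pair_comm`
  (`F(v,u) = F(u,v)`), `subst_pair_assoc`, `subst_pair_zero` (`F(u,0) = u`), `subst_pair_formalNeg`
  (`F(u,i(u)) = 0`), `eq_of_subst_pair_eq_zero` (uniqueness of the inverse), `eq_subst_pair_formalNeg`
  (`F(x,y) = z ⟹ x = F(z,i(y))`), `subst_pair_subst_pair_comm` (`F(F(a,b),F(c,d)) = F(F(a,c),F(b,d))`);
* linear coefficients: `coeff_single_one_formalGroupLaw'` (`F ≡ X₀ + X₁`), `coeff_one_subst_pair`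
  (`(F(u,v))'(0) = u'(0) + v'(0)`), `coeff_one_subst` (`(u∘v)'(0) = u'(0)v'(0)`);
  (`i'(0) = −1` is the tree's `WeierstrassCurve.coeff_one_formalNeg`, `PadicSigma`);
* §2 endomorphisms: `hom_subst_pair` (`h(F(u,v)) = F(h(u),h(v))` for all arguments), **`hom_pair`** (`F(u,v)`
  is an endomorphism if `u, v` are), **`hom_formalNeg`** (`i` is), **`hom_formalMul`** (`[n]` is),
  **`hom_comp`** (`u ∘ v` is), **`formalMul_subst_hom`** (`[n] ∘ h = h ∘ [n]`).

Sequel (same seat): II — the digit expansion `h = [a_J] ⊕ [b_J](Xᵖ) ⊕ [p^J]∘g_J` in `End(F̄)` over `𝔽_p`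
with `p`-adically coherent digits; III — the `ℤ_p`-points `[A] = exp(A·log)` and the exact identity
`h̄ = [A] ⊕ [B](Xᵖ)` (the lead's binder hW3 of the H3_ss assembly).

References: [cite: SilvermanAEC2009, IV.2.1–IV.2.3] (formal group axioms, `[m]`, homomorphisms);
[cite: Katz1981CrystallineDieudonne, §5.3] (the rank of the Dieudonné module; context only).
-/

set_option autoImplicit false
-- single-conjunct summit: `Summit.BirchSwinnertonDyer.BirchSwinnertonDyer.…` repeats the name by design
set_option linter.dupNamespace false

noncomputable section

open PowerSeries Literature.NumberTheory.EllipticCurves Literature.NumberTheory.GaloisRepresentations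

namespace Summit.BirchSwinnertonDyer.BirchSwinnertonDyer.Theorems.FormalEndomorphismAlgebra

/-! ## §1 The formal group law applied to series: associativity, commutativity, zero, inverse -/

section AnyRing

variable {R : Type*} [CommRing R] (W : WeierstrassCurve R)

/-- Substituting into `F(u, v)` substitutes into `u` and `v`. [folklore] -/
theorem subst_subst_pair {σ τ : Type*} {u v : MvPowerSeries σ R}
    (hu : MvPowerSeries.constantCoeff u = 0) (hv : MvPowerSeries.constantCoeff v = 0)
    {s : σ → MvPowerSeries τ R} (hs : MvPowerSeries.HasSubst s) :
    MvPowerSeries.subst s (MvPowerSeries.subst ![u, v] W.formalGroupLaw) =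
      MvPowerSeries.subst ![MvPowerSeries.subst s u, MvPowerSeries.subst s v] W.formalGroupLaw := by
  rw [MvPowerSeries.subst_comp_subst_apply (WeierstrassCurve.hasSubst_pair hu hv) hs]
  congr 1
  funext i
  fin_cases i <;> rfl

/-- One-variable form: `F(u, v)(w) = F(u(w), v(w))`. [folklore] -/
theorem subst_pair_subst {τ : Type*} {u v : R⟦X⟧}
    (hu : constantCoeff u = 0) (hv : constantCoeff v = 0)
    {w : MvPowerSeries τ R} (hw : PowerSeries.HasSubst w) :
    PowerSeries.subst w (MvPowerSeries.subst ![u, v] W.formalGroupLaw) =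
      MvPowerSeries.subst ![u.subst w, v.subst w] W.formalGroupLaw := by
  rw [PowerSeries.subst_def, subst_subst_pair W hu hv hw.const]
  rfl

/-- `F(u, v)` has no constant term. [folklore] -/
theorem constantCoeff_subst_pair {σ : Type*} {u v : MvPowerSeries σ R}
    (hu : MvPowerSeries.constantCoeff u = 0) (hv : MvPowerSeries.constantCoeff v = 0) :
    MvPowerSeries.constantCoeff (MvPowerSeries.subst ![u, v] W.formalGroupLaw) = 0 :=
  MvPowerSeries.constantCoeff_subst_eq_zero (WeierstrassCurve.hasSubst_pair hu hv)
    (fun k => by fin_cases k <;> assumption) W.constantCoeff_formalGroupLaw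

/-- **Commutativity, applied**: `F(v, u) = F(u, v)`. [cite: SilvermanAEC2009, IV.2.1] -/
theorem subst_pair_comm {σ : Type*} {u v : MvPowerSeries σ R}
    (hu : MvPowerSeries.constantCoeff u = 0) (hv : MvPowerSeries.constantCoeff v = 0) :
    MvPowerSeries.subst ![v, u] W.formalGroupLaw = MvPowerSeries.subst ![u, v] W.formalGroupLaw := by
  have hs := WeierstrassCurve.hasSubst_pair hu hv
  have h := congrArg (MvPowerSeries.subst ![u, v]) W.formalGroupLaw_comm'
  rw [subst_subst_pair W (MvPowerSeries.constantCoeff_X 1) (MvPowerSeries.constantCoeff_X 0) hs,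
    MvPowerSeries.subst_X hs, MvPowerSeries.subst_X hs] at h
  exact h

/-- **Associativity, applied**: `F(F(u, v), w) = F(u, F(v, w))`. [cite: SilvermanAEC2009, IV.2.1] -/
theorem subst_pair_assoc {σ : Type*} {u v w : MvPowerSeries σ R}
    (hu : MvPowerSeries.constantCoeff u = 0) (hv : MvPowerSeries.constantCoeff v = 0)
    (hw : MvPowerSeries.constantCoeff w = 0) :
    MvPowerSeries.subst ![MvPowerSeries.subst ![u, v] W.formalGroupLaw, w] W.formalGroupLaw =
      MvPowerSeries.subst ![u, MvPowerSeries.subst ![v, w] W.formalGroupLaw] W.formalGroupLaw := by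
  have hs : MvPowerSeries.HasSubst ![u, v, w] :=
    MvPowerSeries.hasSubst_of_constantCoeff_zero fun k => by
      fin_cases k
      · exact hu
      · exact hv
      · exact hw
  have h := congrArg (MvPowerSeries.subst ![u, v, w]) W.formalGroupLaw_assoc'
  rw [subst_subst_pair W (W.constantCoeff_subst_X_pair_formalGroupLaw 0 1) (MvPowerSeries.constantCoeff_X 2) hs,
    subst_subst_pair W (MvPowerSeries.constantCoeff_X 0) (MvPowerSeries.constantCoeff_X 1) hs,
    subst_subst_pair W (MvPowerSeries.constantCoeff_X 0) (W.constantCoeff_subst_X_pair_formalGroupLaw 1 2) hs,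
    subst_subst_pair W (MvPowerSeries.constantCoeff_X 1) (MvPowerSeries.constantCoeff_X 2) hs,
    MvPowerSeries.subst_X hs, MvPowerSeries.subst_X hs, MvPowerSeries.subst_X hs] at h
  exact h

/-- **Zero, applied**: `F(u, 0) = u`. [cite: SilvermanAEC2009, IV.2.1] -/
theorem subst_pair_zero {σ : Type*} {u : MvPowerSeries σ R} (hu : MvPowerSeries.constantCoeff u = 0) :
    MvPowerSeries.subst ![u, 0] W.formalGroupLaw = u := by
  have h0 : MvPowerSeries.constantCoeff (0 : MvPowerSeries σ R) = 0 := map_zero _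
  rw [subst_pair_comm W h0 hu]
  exact W.formalGroupLaw_subst_zero (PowerSeries.HasSubst.of_constantCoeff_zero hu)

/-- **Inverse, applied**: `F(u, i(u)) = 0`. [cite: SilvermanAEC2009, IV.2.1] -/
theorem subst_pair_formalNeg {σ : Type*} {u : MvPowerSeries σ R} (hu : MvPowerSeries.constantCoeff u = 0) :
    MvPowerSeries.subst ![u, W.formalNeg.subst u] W.formalGroupLaw = 0 := by
  have hw : PowerSeries.HasSubst u := PowerSeries.HasSubst.of_constantCoeff_zero hu
  have h := congrArg (PowerSeries.subst u) W.formalGroupLaw_subst_X_formalNeg'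
  rw [subst_pair_subst W PowerSeries.constantCoeff_X W.constantCoeff_formalNeg hw, PowerSeries.subst_X hw] at h
  rw [h, ← PowerSeries.coe_substAlgHom hw, map_zero]

/-- **Uniqueness of the inverse**: `F(z, u) = 0 = F(z, v) ⟹ u = v`. [folklore] -/
theorem eq_of_subst_pair_eq_zero {σ : Type*} {z u v : MvPowerSeries σ R}
    (hz : MvPowerSeries.constantCoeff z = 0) (hu : MvPowerSeries.constantCoeff u = 0)
    (hv : MvPowerSeries.constantCoeff v = 0)
    (h1 : MvPowerSeries.subst ![z, u] W.formalGroupLaw = 0) (h2 : MvPowerSeries.subst ![z, v] W.formalGroupLaw = 0) :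
    u = v := by
  calc u = MvPowerSeries.subst ![u, 0] W.formalGroupLaw := (subst_pair_zero W hu).symm
    _ = MvPowerSeries.subst ![u, MvPowerSeries.subst ![z, v] W.formalGroupLaw] W.formalGroupLaw := by rw [h2]
    _ = MvPowerSeries.subst ![MvPowerSeries.subst ![u, z] W.formalGroupLaw, v] W.formalGroupLaw :=
        (subst_pair_assoc W hu hz hv).symm
    _ = MvPowerSeries.subst ![MvPowerSeries.subst ![z, u] W.formalGroupLaw, v] W.formalGroupLaw := by
        rw [subst_pair_comm W hz hu]
    _ = v := by rw [h1, W.formalGroupLaw_subst_zero (PowerSeries.HasSubst.of_constantCoeff_zero hv)]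

/-- **Solving `F(x, y) = z` for `x`**: `x = F(z, i(y))`. [folklore] -/
theorem eq_subst_pair_formalNeg {σ : Type*} {x y z : MvPowerSeries σ R}
    (hx : MvPowerSeries.constantCoeff x = 0) (hy : MvPowerSeries.constantCoeff y = 0)
    (h : MvPowerSeries.subst ![x, y] W.formalGroupLaw = z) :
    x = MvPowerSeries.subst ![z, W.formalNeg.subst y] W.formalGroupLaw := by
  have hiy : MvPowerSeries.constantCoeff (W.formalNeg.subst y) = 0 :=
    PowerSeries.constantCoeff_subst_eq_zero hy _ W.constantCoeff_formalNeg
  rw [← h, subst_pair_assoc W hx hy hiy, subst_pair_formalNeg W hy, subst_pair_zero W hx]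

/-- **The middle-four interchange**: `F(F(a, b), F(c, d)) = F(F(a, c), F(b, d))`. [folklore] -/
theorem subst_pair_subst_pair_comm {σ : Type*} {a b c d : MvPowerSeries σ R}
    (ha : MvPowerSeries.constantCoeff a = 0) (hb : MvPowerSeries.constantCoeff b = 0)
    (hc : MvPowerSeries.constantCoeff c = 0) (hd : MvPowerSeries.constantCoeff d = 0) :
    MvPowerSeries.subst ![MvPowerSeries.subst ![a, b] W.formalGroupLaw,
        MvPowerSeries.subst ![c, d] W.formalGroupLaw] W.formalGroupLaw =
      MvPowerSeries.subst ![MvPowerSeries.subst ![a, c] W.formalGroupLaw,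
        MvPowerSeries.subst ![b, d] W.formalGroupLaw] W.formalGroupLaw := by
  rw [subst_pair_assoc W ha hb (constantCoeff_subst_pair W hc hd),
    ← subst_pair_assoc W hb hc hd, subst_pair_comm W hc hb, subst_pair_assoc W hc hb hd,
    ← subst_pair_assoc W ha hc (constantCoeff_subst_pair W hb hd)]

/-- `0 ∘ a = 0`. [folklore] -/
theorem zero_subst {τ : Type*} {S : Type*} [CommRing S] [Algebra R S] {a : MvPowerSeries τ S}
    (ha : PowerSeries.HasSubst a) : PowerSeries.subst a (0 : R⟦X⟧) = 0 := by
  rw [← PowerSeries.coe_substAlgHom ha, map_zero]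

/-! ### Linear coefficients -/

/-- `F ≡ X₀ + X₁ (mod deg 2)`: both linear coefficients of `F` are `1` (any ring). [cite: SilvermanAEC2009, IV.2.1] -/
theorem coeff_single_one_formalGroupLaw' (i : Fin 2) :
    MvPowerSeries.coeff (Finsupp.single i 1) W.formalGroupLaw = 1 := by
  have h1 : MvPowerSeries.coeff (Finsupp.single (1 : Fin 2) 1) W.formalGroupLaw = 1 := by
    rw [← coeff_subst_zero_X W.formalGroupLaw 1, W.formalGroupLaw_subst_zero_X, PowerSeries.coeff_one_X]
  fin_cases i
  · have hc := congrArg (MvPowerSeries.coeff (Finsupp.single (0 : Fin 2) 1)) W.formalGroupLaw_comm'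
    rw [LubinTate.coeff_single_subst (fun j => by fin_cases j <;> exact MvPowerSeries.constantCoeff_X _),
      Fin.sum_univ_two] at hc
    simp only [Matrix.cons_val_zero, Matrix.cons_val_one, MvPowerSeries.coeff_X,
      Finsupp.single_eq_single_iff] at hc
    simpa [h1] using hc.symm
  · exact h1

/-- **`F(u, v) = u + v + O(X²)`**: the linear coefficient is additive. [cite: SilvermanAEC2009, IV.2.1] -/
theorem coeff_one_subst_pair {u v : R⟦X⟧} (hu : constantCoeff u = 0) (hv : constantCoeff v = 0) :
    coeff 1 (MvPowerSeries.subst ![u, v] W.formalGroupLaw) = coeff 1 u + coeff 1 v := by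
  have h := LubinTate.coeff_single_subst (F := W.formalGroupLaw) (b := ![u, v])
    (fun j => by fin_cases j <;> assumption) ()
  rw [Fin.sum_univ_two, coeff_single_one_formalGroupLaw', coeff_single_one_formalGroupLaw', one_mul, one_mul] at h
  exact h

/-- The linear coefficient of a composite: `(u ∘ v)'(0) = u'(0) v'(0)`. [folklore] -/
theorem coeff_one_subst {u v : R⟦X⟧} (hv : constantCoeff v = 0) :
    coeff 1 (u.subst v) = coeff 1 u * coeff 1 v := by
  have h := LubinTate.coeff_single_subst (F := u) (b := fun _ : Unit => v) (fun _ => hv) ()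
  rw [Fintype.sum_unique] at h
  rw [PowerSeries.subst_def]
  exact h

/-! ## §2 Endomorphisms: closure properties

An endomorphism of `F` is a series `h` with `h(0) = 0` and `h(F(X₀, X₁)) = F(h(X₀), h(X₁))`, written out
(no definition is introduced, as in `CyclotomicUntwistFormalEndomorphismFrobenius`). -/

/-- `h(Xᵢ)` has no constant term. [folklore] -/
theorem constantCoeff_subst_X {σ : Type*} {h : R⟦X⟧} (hh0 : constantCoeff h = 0) (i : σ) :
    MvPowerSeries.constantCoeff (h.subst (MvPowerSeries.X i : MvPowerSeries σ R)) = 0 :=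
  PowerSeries.constantCoeff_subst_eq_zero (MvPowerSeries.constantCoeff_X i) _ hh0

/-- **An endomorphism is additive on all arguments**: `h(F(u, v)) = F(h(u), h(v))`. [folklore] -/
theorem hom_subst_pair {h : R⟦X⟧} (hh0 : constantCoeff h = 0)
    (hh : h.subst W.formalGroupLaw =
      MvPowerSeries.subst ![h.subst (MvPowerSeries.X 0 : MvPowerSeries (Fin 2) R),
        h.subst (MvPowerSeries.X 1 : MvPowerSeries (Fin 2) R)] W.formalGroupLaw)
    {τ : Type*} {u v : MvPowerSeries τ R}
    (hu : MvPowerSeries.constantCoeff u = 0) (hv : MvPowerSeries.constantCoeff v = 0) :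
    h.subst (MvPowerSeries.subst ![u, v] W.formalGroupLaw) =
      MvPowerSeries.subst ![h.subst u, h.subst v] W.formalGroupLaw := by
  have hs := WeierstrassCurve.hasSubst_pair hu hv
  have e := congrArg (MvPowerSeries.subst ![u, v]) hh
  rw [mvSubst_powerSeries_subst W.hasSubst_formalGroupLaw hs,
    subst_subst_pair W (constantCoeff_subst_X hh0 0) (constantCoeff_subst_X hh0 1) hs,
    mvSubst_powerSeries_subst (PowerSeries.HasSubst.X 0) hs,
    mvSubst_powerSeries_subst (PowerSeries.HasSubst.X 1) hs,
    MvPowerSeries.subst_X hs, MvPowerSeries.subst_X hs] at e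
  exact e

/-- **The sum of two endomorphisms is an endomorphism.** [folklore] -/
theorem hom_pair {u v : R⟦X⟧} (hu0 : constantCoeff u = 0)
    (hu : u.subst W.formalGroupLaw =
      MvPowerSeries.subst ![u.subst (MvPowerSeries.X 0 : MvPowerSeries (Fin 2) R),
        u.subst (MvPowerSeries.X 1 : MvPowerSeries (Fin 2) R)] W.formalGroupLaw)
    (hv0 : constantCoeff v = 0)
    (hv : v.subst W.formalGroupLaw =
      MvPowerSeries.subst ![v.subst (MvPowerSeries.X 0 : MvPowerSeries (Fin 2) R),
        v.subst (MvPowerSeries.X 1 : MvPowerSeries (Fin 2) R)] W.formalGroupLaw) :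
    PowerSeries.subst W.formalGroupLaw (MvPowerSeries.subst ![u, v] W.formalGroupLaw) =
      MvPowerSeries.subst ![PowerSeries.subst (MvPowerSeries.X 0 : MvPowerSeries (Fin 2) R)
          (MvPowerSeries.subst ![u, v] W.formalGroupLaw),
        PowerSeries.subst (MvPowerSeries.X 1 : MvPowerSeries (Fin 2) R)
          (MvPowerSeries.subst ![u, v] W.formalGroupLaw)] W.formalGroupLaw := by
  rw [subst_pair_subst W hu0 hv0 W.hasSubst_formalGroupLaw, subst_pair_subst W hu0 hv0 (PowerSeries.HasSubst.X 0),
    subst_pair_subst W hu0 hv0 (PowerSeries.HasSubst.X 1), hu, hv]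
  exact subst_pair_subst_pair_comm W (constantCoeff_subst_X hu0 0) (constantCoeff_subst_X hu0 1)
    (constantCoeff_subst_X hv0 0) (constantCoeff_subst_X hv0 1)

/-- `F(X₀, X₁) = F`. [folklore] -/
theorem subst_X_pair_self :
    MvPowerSeries.subst ![(MvPowerSeries.X 0 : MvPowerSeries (Fin 2) R), MvPowerSeries.X 1] W.formalGroupLaw =
      W.formalGroupLaw := by
  have e : (![(MvPowerSeries.X 0 : MvPowerSeries (Fin 2) R), MvPowerSeries.X 1]) = MvPowerSeries.X := by
    funext i; fin_cases i <;> rfl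
  rw [e, MvPowerSeries.subst_self]
  rfl

/-- **The inverse `i` is an endomorphism** (any ring): both `i(F)` and `F(i(X₀), i(X₁))` are inverses of `F`.
[cite: SilvermanAEC2009, IV.2.3] -/
theorem hom_formalNeg :
    W.formalNeg.subst W.formalGroupLaw =
      MvPowerSeries.subst ![W.formalNeg.subst (MvPowerSeries.X 0 : MvPowerSeries (Fin 2) R),
        W.formalNeg.subst (MvPowerSeries.X 1 : MvPowerSeries (Fin 2) R)] W.formalGroupLaw := by
  have hF0 := W.constantCoeff_formalGroupLaw
  have hi0 := W.constantCoeff_formalNeg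
  refine eq_of_subst_pair_eq_zero W hF0 (PowerSeries.constantCoeff_subst_eq_zero hF0 _ hi0)
    (constantCoeff_subst_pair W (constantCoeff_subst_X hi0 0) (constantCoeff_subst_X hi0 1))
    (subst_pair_formalNeg W hF0) ?_
  conv_lhs => rw [show (![W.formalGroupLaw, MvPowerSeries.subst ![W.formalNeg.subst (MvPowerSeries.X 0 :
      MvPowerSeries (Fin 2) R), W.formalNeg.subst (MvPowerSeries.X 1 : MvPowerSeries (Fin 2) R)] W.formalGroupLaw]) =
      ![MvPowerSeries.subst ![(MvPowerSeries.X 0 : MvPowerSeries (Fin 2) R), MvPowerSeries.X 1] W.formalGroupLaw,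
        MvPowerSeries.subst ![W.formalNeg.subst (MvPowerSeries.X 0 : MvPowerSeries (Fin 2) R),
          W.formalNeg.subst (MvPowerSeries.X 1 : MvPowerSeries (Fin 2) R)] W.formalGroupLaw] by
      rw [subst_X_pair_self]]
  rw [subst_pair_subst_pair_comm W (MvPowerSeries.constantCoeff_X 0) (MvPowerSeries.constantCoeff_X 1)
    (constantCoeff_subst_X hi0 0) (constantCoeff_subst_X hi0 1),
    subst_pair_formalNeg W (MvPowerSeries.constantCoeff_X 0), subst_pair_formalNeg W (MvPowerSeries.constantCoeff_X 1),
    subst_pair_zero W (map_zero _)]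

/-- **`[n]` is an endomorphism** (any ring), by induction from `[n+1] = F(X, [n])`. [cite: SilvermanAEC2009, IV.2.3] -/
theorem hom_formalMul (n : ℕ) :
    (W.formalMul n).subst W.formalGroupLaw =
      MvPowerSeries.subst ![(W.formalMul n).subst (MvPowerSeries.X 0 : MvPowerSeries (Fin 2) R),
        (W.formalMul n).subst (MvPowerSeries.X 1 : MvPowerSeries (Fin 2) R)] W.formalGroupLaw := by
  induction n with
  | zero =>
    rw [W.formalMul_zero, zero_subst W.hasSubst_formalGroupLaw, zero_subst (PowerSeries.HasSubst.X 0),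
      zero_subst (PowerSeries.HasSubst.X 1), subst_pair_zero W (map_zero _)]
  | succ n ih =>
    have hn0 := W.constantCoeff_formalMul n
    rw [W.formalMul_succ'', subst_pair_subst W PowerSeries.constantCoeff_X hn0 W.hasSubst_formalGroupLaw,
      subst_pair_subst W PowerSeries.constantCoeff_X hn0 (PowerSeries.HasSubst.X 0),
      subst_pair_subst W PowerSeries.constantCoeff_X hn0 (PowerSeries.HasSubst.X 1),
      PowerSeries.subst_X W.hasSubst_formalGroupLaw, PowerSeries.subst_X (PowerSeries.HasSubst.X 0),
      PowerSeries.subst_X (PowerSeries.HasSubst.X 1), ih]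
    rw [show (![W.formalGroupLaw, MvPowerSeries.subst ![(W.formalMul n).subst (MvPowerSeries.X 0 :
        MvPowerSeries (Fin 2) R), (W.formalMul n).subst (MvPowerSeries.X 1 : MvPowerSeries (Fin 2) R)]
          W.formalGroupLaw] : Fin 2 → MvPowerSeries (Fin 2) R) =
        ![MvPowerSeries.subst ![(MvPowerSeries.X 0 : MvPowerSeries (Fin 2) R), MvPowerSeries.X 1] W.formalGroupLaw,
          MvPowerSeries.subst ![(W.formalMul n).subst (MvPowerSeries.X 0 : MvPowerSeries (Fin 2) R),
            (W.formalMul n).subst (MvPowerSeries.X 1 : MvPowerSeries (Fin 2) R)] W.formalGroupLaw] by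
      rw [subst_X_pair_self]]
    exact subst_pair_subst_pair_comm W (MvPowerSeries.constantCoeff_X 0) (MvPowerSeries.constantCoeff_X 1)
      (constantCoeff_subst_X hn0 0) (constantCoeff_subst_X hn0 1)

/-- **The composite of two endomorphisms is an endomorphism.** [folklore] -/
theorem hom_comp {u v : R⟦X⟧} (hu0 : constantCoeff u = 0)
    (hu : u.subst W.formalGroupLaw =
      MvPowerSeries.subst ![u.subst (MvPowerSeries.X 0 : MvPowerSeries (Fin 2) R),
        u.subst (MvPowerSeries.X 1 : MvPowerSeries (Fin 2) R)] W.formalGroupLaw)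
    (hv0 : constantCoeff v = 0)
    (hv : v.subst W.formalGroupLaw =
      MvPowerSeries.subst ![v.subst (MvPowerSeries.X 0 : MvPowerSeries (Fin 2) R),
        v.subst (MvPowerSeries.X 1 : MvPowerSeries (Fin 2) R)] W.formalGroupLaw) :
    PowerSeries.subst W.formalGroupLaw (u.subst v) =
      MvPowerSeries.subst ![PowerSeries.subst (MvPowerSeries.X 0 : MvPowerSeries (Fin 2) R) (u.subst v),
        PowerSeries.subst (MvPowerSeries.X 1 : MvPowerSeries (Fin 2) R) (u.subst v)] W.formalGroupLaw := by
  have hvs : PowerSeries.HasSubst v := PowerSeries.HasSubst.of_constantCoeff_zero' hv0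
  rw [PowerSeries.subst_comp_subst_apply hvs W.hasSubst_formalGroupLaw,
    PowerSeries.subst_comp_subst_apply hvs (PowerSeries.HasSubst.X 0),
    PowerSeries.subst_comp_subst_apply hvs (PowerSeries.HasSubst.X 1), hv,
    hom_subst_pair W hu0 hu (constantCoeff_subst_X hv0 0) (constantCoeff_subst_X hv0 1)]

/-- **Endomorphisms commute with `[n]`**: `[n](h(X)) = h([n](X))`. [cite: SilvermanAEC2009, IV.2.3] -/
theorem formalMul_subst_hom {h : R⟦X⟧} (hh0 : constantCoeff h = 0)
    (hh : h.subst W.formalGroupLaw =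
      MvPowerSeries.subst ![h.subst (MvPowerSeries.X 0 : MvPowerSeries (Fin 2) R),
        h.subst (MvPowerSeries.X 1 : MvPowerSeries (Fin 2) R)] W.formalGroupLaw) (n : ℕ) :
    (W.formalMul n).subst h = h.subst (W.formalMul n) := by
  have hhs : PowerSeries.HasSubst h := PowerSeries.HasSubst.of_constantCoeff_zero' hh0
  induction n with
  | zero =>
    rw [W.formalMul_zero, PowerSeries.subst_zero_of_constantCoeff_zero hh0, zero_subst hhs]
  | succ n ih =>
    rw [W.formalMul_succ'', subst_pair_subst W PowerSeries.constantCoeff_X (W.constantCoeff_formalMul n) hhs,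
      PowerSeries.subst_X hhs, ih,
      hom_subst_pair W hh0 hh PowerSeries.constantCoeff_X (W.constantCoeff_formalMul n), PowerSeries.X_subst]

end AnyRing

end Summit.BirchSwinnertonDyer.BirchSwinnertonDyer.Theorems.FormalEndomorphismAlgebra

end
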